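/-
Copyright: cell pub-balaban-gaps (YM BLITZ Y1, track G1), seat g1-p2 GEN 6 (unit `pub-balaban-gaps-g1-p2`).  Row (D4) NODE O,
OBJECT ∕ MECHANISM level: the one operator letter of the (U) road — UNIFORM CONJUGATED COERCIVITY on the analyticity ball (`hcoer` of
files 36, 47, 50, 52) — DERIVED from print-shaped inputs: positivity of the REAL operator ([B9] Thm 3.11), finite range, and a Schur
budget of the COMPLEX remainder ([B9] (3.37), (3.63)–(3.64)).  Composition of the prior engine's budget algebra
(`Beta/AccretiveCombesThomas*`, b2b-balaban-beta-d4-p3) and file 36 BY NAME.  HONEST FRAMING: [folklore] linear algebra over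
hypothesis SHAPES; nothing of Bałaban's constructed or asserted; (D4) NOT discharged (instance 0∕1); NOT BetaPertH, NOT continuum,
NOT Clay.
-/
import Summits.QuantumFields.BalabanUV.Gaps.D4WalkBlockLocalInverse
import Summits.QuantumFields.BalabanUV.Beta.AccretiveCombesThomasBudget

/-!
# `Gaps.D4WalkBlockCoerciveLetter` — the `hcoer` letter from Thm 3.11-shape positivity, finite range, and the complex remainder's
# Schur budget (cell pub-balaban-gaps, seat g1-p2 GEN 6)

HONEST DEPENDENCY (cell pub-balaban, verbatim): continuum YM on T⁴ ⇐ BetaPertH ∧ nine spine estimates (0/9 proved);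
BetaPertH ⇐ (D1) ∧ (D4) ∧ CAP+tail.

WHY.  After files 49–52 the (U)-road's one-scale END asks of the operator `Δ′(u) = 1 + K′₀(u) (+ K′₁(u))` ONE coercivity letter:
`hcoer : ∀ u ∈ ball 0 R, ∀ j z, m‖z‖² ≤ Re conjForm (1 + K′₀(u)) κ_c (ds(·,j)) z` — conjugated coercivity at rate `κ_c` along every
column weight, UNIFORMLY on the analyticity ball (RESIDUE (D4) v1.16: «k-free uniform conjugated coercivity of Δ^{(k)}»).  Print has:
[B9] Thm 3.11 p. 416 *«the operators Δ′_a, G′, (Q′G′²Q′*)⁻¹, Δ_a, G are positive definite»* — positivity of the REAL (Hermitian)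
operator —; finite range of `Δ′_a` ((3.24) p. 394); and for COMPLEX configurations `U′U`, `U′ = e^{iηA}` on the domain (3.37) p. 396,
the perturbative treatment (3.63)–(3.64) p. 402 *«G′(U′U) = G′(U)(I − V′(A)G′(U))⁻¹ = Σ G′(U)(V′(A)G′(U))ⁿ»* with `V′(A)` small.  THIS
FILE turns exactly these three inputs into `hcoer` (the located J-2a-u★ shape of RESIDUE (D4) v1.11–v1.15):
* §1 `cRow_le_of_range` ∕ `cCol_le_of_range`, `cRow_le_of_decay` ∕ `cCol_le_of_decay` — 36's conjugated Schur sums of a remainder from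
  a RANGE letter or from an ENTRY-DECAY letter + site row-sum profile (the weight `ds(·,j)` is `ds`-Lipschitz by the triangle inequality);
* §2 **`conjCoercive_of_hermitian_range`** — a Hermitian `H`, Re-coercive `γ` (Thm 3.11-shape), of `ds`-range `r₁` with absolute row
  sums `≤ M_H`, is conjugated-coercive `γ − M_H(e^{κr₁} − 1)` at every rate `κ ≥ 0` along every column weight (the prior engine's cosh
  budget `conjLower_of_isHermitian` + `ctRowDefect_le_of_range` + `conjCoercive_of_conjLower`, BY NAME);
* §3 **`hcoer_of_hermitian_range_schur`** — THE LETTER: `A(u) = H + R(u)` on the ball with `H` as in §2 and conjugated Schur sums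
  `(c_r, c_c)` of the complex remainder `R(u)` ⟹ `∀ u ∈ ball, ∀ j z, (γ − M_H(e^{κr₁}−1) − ½(c_r+c_c))‖z‖² ≤ Re conjForm (A u) κ (ds(·,j)) z`
  (36's `conjCoercive_uniform_of_schur`); `hcoer_of_hermitian_range_decay` — the same with the remainder given by an entry-decay letter
  `‖R(u)(e,e′)‖ ≤ θe^{−κ₀ds(e,e′)}` and the profile `Σ_{e′} e^{−(κ₀−κ)ds(e,e′)} ≤ L`: margin `γ − M_H(e^{κr₁}−1) − θL`.
* §4 **`reCoercive_of_inv_schur`** — WHAT `γ` IS (planner g1-plan-1 GEN 17, L-19a): Thm 3.11's QUALITATIVE positivity + a Schur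
  bound `S` of the INVERSE's rows and columns (a (3.42)-type letter on `G′ = Δ′⁻¹`, summed) ⟹ `γ = S⁻¹`; `re_star_dotProduct_mulVec_comm`.
* §5 (v1.2 append; planner g1-plan-1 GEN 17's skeleton #20 b75c9f421972c15c PORTED WITH CREDIT) — the COSH packaging:
  `ctRowDefect_le_of_range_cosh` (off-diagonal mass, `cosh(κr) − 1`: SECOND order), **`conjCoercive_of_hermitian_range_cosh`**,
  **`hcoer_of_hermitian_range_schur_cosh`** (margin `γ − M_off(cosh(κr₁) − 1) − ½(c_r + c_c)`), `cosh_sub_one_le`,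
  `lapShape_cosh_budget_le` (`(2d∕η²)(cosh(κη) − 1) ≤ dκ²e^{(κη)²∕2}`: η-UNIFORM for nearest-neighbour fine-lattice Laplacian shapes,
  where §2's first-order packaging is not — plan-1 L-19b).
So an instance owes: `γ` = Thm 3.11 for Δ^{(k)}(U) + the k-uniform bound of its inverse (§4), `(r₁, M_H)` (range and row bound of the
real operator), and `(θ, κ₀)` or `(c_r, c_c)` (the size of `Δ′(U′U) − Δ′(U)` on the (3.37)-ball) — and nothing else for `hcoer`.
Value: bookkeeping; words UNCHANGED.

References: T. Bałaban, Comm. Math. Phys. 99 (1985) 389–434 [B9], (3.24) p.394, (3.37) p.396, (3.63)–(3.64) p.402, Thm 3.11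
p.416; Comm. Math. Phys. 116 (1988) 1–22 [II], (1.17)–(1.18) p.7, p.15.  Method: J.-M. Combes, L. Thomas, Commun. Math. Phys. 34
(1973) 251–270 [folklore].
-/

noncomputable section

namespace Summit.QuantumFields.BalabanUV.Gaps.D4WalkBlockCoerciveLetter

open Metric Set Finset Matrix
open Literature.MathematicalPhysics.QuantumFieldTheory.Balaban1983to89
open Literature.MathematicalPhysics.QuantumFieldTheory.Balaban1983to89.B5Prop11Lower (nsq nsq_nonneg star_dotProduct_self)
open Literature.MathematicalPhysics.QuantumFieldTheory.Balaban1983to89.Beta.DeltaACombesThomas (ctRowDefect)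
open Summit.QuantumFields.BalabanUV.Gaps.D4WalkBlockLocalInverse (cRow cCol norm_conjForm_le_schur conjCoercive_uniform_of_schur)
open Summit.QuantumFields.BalabanUV.Beta.AccretiveCombesThomas (conjForm conjForm_zero_rate conjCoercive_of_conjLower)
open Summit.QuantumFields.BalabanUV.Beta.AccretiveCombesThomasBudget (conjLower_of_isHermitian ctRowDefect_le_of_range)

variable {ι : Type*} [Fintype ι]

/-! ## §1. Conjugated Schur sums of a remainder from range or from entry decay -/

section Schur

variable (ds : ι → ι → ℝ)

omit [Fintype ι] in
/-- The column weight `ds(·,j)` is `ds`-Lipschitz: `ds(e,j) − ds(e′,j) ≤ ds(e,e′)` (triangle inequality + symmetry). [folklore] -/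
theorem weight_sub_le (htri : ∀ i j k, ds i k ≤ ds i j + ds j k) (j e e' : ι) :
    ds e j - ds e' j ≤ ds e e' := by
  have h := htri e e' j
  linarith

omit [Fintype ι] in
/-- … in absolute value. [folklore] -/
theorem abs_weight_sub_le (hsymm : ∀ i j, ds i j = ds j i) (htri : ∀ i j k, ds i k ≤ ds i j + ds j k) (j e e' : ι) :
    |ds e j - ds e' j| ≤ ds e e' := by
  rw [abs_le]
  refine ⟨?_, weight_sub_le ds htri j e e'⟩
  have h := weight_sub_le ds htri j e' e
  rw [hsymm e' e] at h
  linarith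

/-- **Conjugated ROW sum from RANGE**: `R(e,e′) ≠ 0 ⟹ ds(e,e′) ≤ r`, absolute row sums `≤ M_R`, `κ ≥ 0` ⟹
`cRow R κ (ds(·,j)) e ≤ M_R·e^{κr}`. [folklore] -/
theorem cRow_le_of_range (htri : ∀ i j k, ds i k ≤ ds i j + ds j k)
    (R : Matrix ι ι ℂ) {κ r MR : ℝ} (hκ : 0 ≤ κ) (hrange : ∀ e e', R e e' ≠ 0 → ds e e' ≤ r)
    (hrow : ∀ e, ∑ e', ‖R e e'‖ ≤ MR) (j e : ι) :
    cRow R κ (fun e => ds e j) e ≤ MR * Real.exp (κ * r) := by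
  unfold cRow
  calc ∑ e', ‖R e e'‖ * Real.exp (κ * (ds e j - ds e' j))
      ≤ ∑ e', ‖R e e'‖ * Real.exp (κ * r) := by
        refine Finset.sum_le_sum fun e' _ => ?_
        by_cases h0 : R e e' = 0
        · simp [h0]
        · refine mul_le_mul_of_nonneg_left (Real.exp_le_exp.2 (mul_le_mul_of_nonneg_left ?_ hκ)) (norm_nonneg _)
          exact (weight_sub_le ds htri j e e').trans (hrange e e' h0)
    _ = (∑ e', ‖R e e'‖) * Real.exp (κ * r) := by rw [Finset.sum_mul]
    _ ≤ MR * Real.exp (κ * r) := mul_le_mul_of_nonneg_right (hrow e) (Real.exp_nonneg _)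

/-- **Conjugated COLUMN sum from RANGE** (absolute column sums `≤ M_C`). [folklore] -/
theorem cCol_le_of_range (htri : ∀ i j k, ds i k ≤ ds i j + ds j k)
    (R : Matrix ι ι ℂ) {κ r MC : ℝ} (hκ : 0 ≤ κ) (hrange : ∀ e e', R e e' ≠ 0 → ds e e' ≤ r)
    (hcol : ∀ e', ∑ e, ‖R e e'‖ ≤ MC) (j e' : ι) :
    cCol R κ (fun e => ds e j) e' ≤ MC * Real.exp (κ * r) := by
  unfold cCol
  calc ∑ e, ‖R e e'‖ * Real.exp (κ * (ds e j - ds e' j))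
      ≤ ∑ e, ‖R e e'‖ * Real.exp (κ * r) := by
        refine Finset.sum_le_sum fun e _ => ?_
        by_cases h0 : R e e' = 0
        · simp [h0]
        · refine mul_le_mul_of_nonneg_left (Real.exp_le_exp.2 (mul_le_mul_of_nonneg_left ?_ hκ)) (norm_nonneg _)
          exact (weight_sub_le ds htri j e e').trans (hrange e e' h0)
    _ = (∑ e, ‖R e e'‖) * Real.exp (κ * r) := by rw [Finset.sum_mul]
    _ ≤ MC * Real.exp (κ * r) := mul_le_mul_of_nonneg_right (hcol e') (Real.exp_nonneg _)

/-- **Conjugated ROW sum from ENTRY DECAY**: `‖R(e,e′)‖ ≤ θe^{−κ₀ds(e,e′)}`, `κ ≥ 0`, profile `Σ_{e′} e^{−(κ₀−κ)ds(e,e′)} ≤ L` ⟹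
`cRow R κ (ds(·,j)) e ≤ θL` — the shape of [B9] (3.63)'s small non-local remainder. [cite: Balaban1985BackgroundPropagators, (3.63) p.402] -/
theorem cRow_le_of_decay (htri : ∀ i j k, ds i k ≤ ds i j + ds j k)
    (R : Matrix ι ι ℂ) {κ κ₀ θ L : ℝ} (hκ : 0 ≤ κ) (hθ : 0 ≤ θ)
    (hR : ∀ e e', ‖R e e'‖ ≤ θ * Real.exp (-(κ₀ * ds e e'))) (hL : ∀ e, ∑ e', Real.exp (-((κ₀ - κ) * ds e e')) ≤ L)
    (j e : ι) : cRow R κ (fun e => ds e j) e ≤ θ * L := by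
  unfold cRow
  calc ∑ e', ‖R e e'‖ * Real.exp (κ * (ds e j - ds e' j))
      ≤ ∑ e', θ * Real.exp (-(κ₀ * ds e e')) * Real.exp (κ * ds e e') :=
        Finset.sum_le_sum fun e' _ => mul_le_mul (hR e e')
          (Real.exp_le_exp.2 (mul_le_mul_of_nonneg_left (weight_sub_le ds htri j e e') hκ)) (Real.exp_nonneg _)
          (mul_nonneg hθ (Real.exp_nonneg _))
    _ = θ * ∑ e', Real.exp (-((κ₀ - κ) * ds e e')) := by
        rw [Finset.mul_sum]
        refine Finset.sum_congr rfl fun e' _ => ?_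
        rw [mul_assoc, ← Real.exp_add]; ring_nf
    _ ≤ θ * L := mul_le_mul_of_nonneg_left (hL e) hθ

/-- **Conjugated COLUMN sum from ENTRY DECAY** (column profile `Σ_e e^{−(κ₀−κ)ds(e,e′)} ≤ L`). [cite: Balaban1985BackgroundPropagators, (3.63) p.402] -/
theorem cCol_le_of_decay (htri : ∀ i j k, ds i k ≤ ds i j + ds j k)
    (R : Matrix ι ι ℂ) {κ κ₀ θ L : ℝ} (hκ : 0 ≤ κ) (hθ : 0 ≤ θ)
    (hR : ∀ e e', ‖R e e'‖ ≤ θ * Real.exp (-(κ₀ * ds e e'))) (hL : ∀ e', ∑ e, Real.exp (-((κ₀ - κ) * ds e e')) ≤ L)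
    (j e' : ι) : cCol R κ (fun e => ds e j) e' ≤ θ * L := by
  unfold cCol
  calc ∑ e, ‖R e e'‖ * Real.exp (κ * (ds e j - ds e' j))
      ≤ ∑ e, θ * Real.exp (-(κ₀ * ds e e')) * Real.exp (κ * ds e e') :=
        Finset.sum_le_sum fun e _ => mul_le_mul (hR e e')
          (Real.exp_le_exp.2 (mul_le_mul_of_nonneg_left (weight_sub_le ds htri j e e') hκ)) (Real.exp_nonneg _)
          (mul_nonneg hθ (Real.exp_nonneg _))
    _ = θ * ∑ e, Real.exp (-((κ₀ - κ) * ds e e')) := by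
        rw [Finset.mul_sum]
        refine Finset.sum_congr rfl fun e _ => ?_
        rw [mul_assoc, ← Real.exp_add]; ring_nf
    _ ≤ θ * L := mul_le_mul_of_nonneg_left (hL e') hθ

end Schur

/-! ## §2. A Re-coercive Hermitian kernel of finite range is conjugated-coercive along every column weight -/

section Hermitian

variable (ds : ι → ι → ℝ)

/-- **CONJUGATED COERCIVITY FROM Thm 3.11-SHAPE POSITIVITY + FINITE RANGE** (Combes–Thomas): a Hermitian `H` with
`γ‖z‖² ≤ Re z^*Hz`, entries vanishing unless `ds(e,e′) ≤ r₁` (`r₁ ≥ 0`) and absolute row sums `≤ M_H`, and a symmetric `ds` with the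
triangle inequality ⟹ for every `κ ≥ 0` and every column `j`: `(γ − M_H(e^{κr₁} − 1))‖z‖² ≤ Re conjForm H κ (ds(·,j)) z` (cosh budget
of the prior engine + range defect, BY NAME). [cite: Balaban1985BackgroundPropagators, Thm 3.11 p.416, (3.24) p.394] -/
theorem conjCoercive_of_hermitian_range (hsymm : ∀ i j, ds i j = ds j i) (htri : ∀ i j k, ds i k ≤ ds i j + ds j k)
    (H : Matrix ι ι ℂ) (hH : H.IsHermitian) {γ κ r₁ MH : ℝ} (hκ : 0 ≤ κ) (hr₁ : 0 ≤ r₁)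
    (hγ : ∀ z : ι → ℂ, γ * nsq z ≤ (star z ⬝ᵥ (H *ᵥ z)).re)
    (hrange : ∀ e e', H e e' ≠ 0 → ds e e' ≤ r₁) (hrow : ∀ e, ∑ e', ‖H e e'‖ ≤ MH) (j : ι) :
    ∀ z : ι → ℂ, (γ - MH * (Real.exp (κ * r₁) - 1)) * nsq z ≤ (conjForm H κ (fun e => ds e j) z).re := by
  have hJ : ∀ e, ctRowDefect H κ (fun e => ds e j) e ≤ MH * (Real.exp (κ * r₁) - 1) :=
    ctRowDefect_le_of_range H hκ hr₁ (fun e => ds e j)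
      (fun e e' hne => (abs_weight_sub_le ds hsymm htri j e e').trans (hrange e e' hne)) hrow
  exact conjCoercive_of_conjLower hγ (conjLower_of_isHermitian H hH κ (fun e => ds e j) hJ)

end Hermitian

/-! ## §3. THE LETTER: uniform conjugated coercivity on the ball from the real operator and the complex remainder's budget -/

section Letter

variable {E : Type*} [NormedAddCommGroup E] (ds : ι → ι → ℝ)

/-- **`hcoer` FROM PRINT-SHAPED INPUTS**: `A(u) = H + R(u)` on the `R`-ball, `H` Hermitian, Re-coercive `γ` ([B9] Thm 3.11-shape), of
`ds`-range `r₁` with row sums `≤ M_H`; the complex remainder `R(u)` with conjugated Schur sums `≤ c_r`, `≤ c_c` along every column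
weight, uniformly on the ball ([B9] (3.37) ∕ (3.63): `Δ′(U′U) − Δ′(U)` small) ⟹
`∀ u ∈ ball, ∀ j z, (γ − M_H(e^{κr₁} − 1) − ½(c_r + c_c))‖z‖² ≤ Re conjForm (A u) κ (ds(·,j)) z` — literally the `hcoer` hypothesis of
`Gaps/D4WalkBlockAccretiveDecay.blockWalkExpansion_accretive_print` ∕ `Gaps/D4WalkBlockAccretiveTail.blockWalkExpansion_accretive_tail`
with `m := γ − M_H(e^{κr₁} − 1) − ½(c_r + c_c)` and `1 + K′₀(u) := A(u)`.
[cite: Balaban1985BackgroundPropagators, Thm 3.11 p.416, (3.37) p.396, (3.63)–(3.64) p.402; Balaban1988RG2Cluster, (1.17)–(1.18) p.7, p.15] -/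
theorem hcoer_of_hermitian_range_schur (hsymm : ∀ i j, ds i j = ds j i) (htri : ∀ i j k, ds i k ≤ ds i j + ds j k)
    {A : E → Matrix ι ι ℂ} (H : Matrix ι ι ℂ) (hH : H.IsHermitian) {R γ κ r₁ MH cr cc : ℝ} (hκ : 0 ≤ κ) (hr₁ : 0 ≤ r₁)
    (hγ : ∀ z : ι → ℂ, γ * nsq z ≤ (star z ⬝ᵥ (H *ᵥ z)).re)
    (hrange : ∀ e e', H e e' ≠ 0 → ds e e' ≤ r₁) (hrow : ∀ e, ∑ e', ‖H e e'‖ ≤ MH)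
    (hr : ∀ u ∈ ball (0 : E) R, ∀ j e, cRow (A u - H) κ (fun e => ds e j) e ≤ cr)
    (hc : ∀ u ∈ ball (0 : E) R, ∀ j e', cCol (A u - H) κ (fun e => ds e j) e' ≤ cc) :
    ∀ u ∈ ball (0 : E) R, ∀ j, ∀ z : ι → ℂ,
      (γ - MH * (Real.exp (κ * r₁) - 1) - (cr + cc) / 2) * nsq z ≤ (conjForm (A u) κ (fun e => ds e j) z).re :=
  conjCoercive_uniform_of_schur H ds (conjCoercive_of_hermitian_range ds hsymm htri H hH hκ hr₁ hγ hrange hrow) hr hc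

/-- **`hcoer` WITH THE REMAINDER GIVEN BY AN ENTRY-DECAY LETTER**: as above with `‖(A(u) − H)(e,e′)‖ ≤ θe^{−κ₀ds(e,e′)}` on the ball
and the two-sided profile `Σ_{e′} e^{−(κ₀−κ)ds(e,e′)} ≤ L`: margin `γ − M_H(e^{κr₁} − 1) − θL`.
[cite: Balaban1985BackgroundPropagators, Thm 3.11 p.416, (3.63) p.402] -/
theorem hcoer_of_hermitian_range_decay (hsymm : ∀ i j, ds i j = ds j i) (htri : ∀ i j k, ds i k ≤ ds i j + ds j k)
    {A : E → Matrix ι ι ℂ} (H : Matrix ι ι ℂ) (hH : H.IsHermitian) {R γ κ κ₀ r₁ MH θ L : ℝ} (hκ : 0 ≤ κ) (hr₁ : 0 ≤ r₁)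
    (hθ : 0 ≤ θ)
    (hγ : ∀ z : ι → ℂ, γ * nsq z ≤ (star z ⬝ᵥ (H *ᵥ z)).re)
    (hrange : ∀ e e', H e e' ≠ 0 → ds e e' ≤ r₁) (hrow : ∀ e, ∑ e', ‖H e e'‖ ≤ MH)
    (hRbd : ∀ u ∈ ball (0 : E) R, ∀ e e', ‖(A u - H) e e'‖ ≤ θ * Real.exp (-(κ₀ * ds e e')))
    (hL : ∀ e, ∑ e', Real.exp (-((κ₀ - κ) * ds e e')) ≤ L) :
    ∀ u ∈ ball (0 : E) R, ∀ j, ∀ z : ι → ℂ,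
      (γ - MH * (Real.exp (κ * r₁) - 1) - θ * L) * nsq z ≤ (conjForm (A u) κ (fun e => ds e j) z).re := by
  have hL' : ∀ e', ∑ e, Real.exp (-((κ₀ - κ) * ds e e')) ≤ L := fun e' => by
    have h := hL e'
    calc ∑ e, Real.exp (-((κ₀ - κ) * ds e e')) = ∑ e, Real.exp (-((κ₀ - κ) * ds e' e)) :=
          Finset.sum_congr rfl fun e _ => by rw [hsymm e e']
      _ ≤ L := h
  have h := hcoer_of_hermitian_range_schur ds hsymm htri H hH hκ hr₁ hγ hrange hrow
    (fun u hu j e => cRow_le_of_decay ds htri (A u - H) hκ hθ (hRbd u hu) hL j e)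
    (fun u hu j e' => cCol_le_of_decay ds htri (A u - H) hκ hθ (hRbd u hu) hL' j e')
  intro u hu j z
  have h1 := h u hu j z
  have e : γ - MH * (Real.exp (κ * r₁) - 1) - (θ * L + θ * L) / 2 = γ - MH * (Real.exp (κ * r₁) - 1) - θ * L := by ring
  rw [e] at h1
  exact h1

end Letter

/-! ## §4. What `γ` is: Thm 3.11's positivity + a Schur bound of the INVERSE ((3.42)-type) give the coercivity constant -/

section Gamma

/-- Hermitian symmetry of the real part of the form: `Re a^*Hb = Re b^*Ha`. [folklore] -/
theorem re_star_dotProduct_mulVec_comm (H : Matrix ι ι ℂ) (hH : H.IsHermitian) (a b : ι → ℂ) :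
    (star a ⬝ᵥ (H *ᵥ b)).re = (star b ⬝ᵥ (H *ᵥ a)).re := by
  have h : star a ⬝ᵥ (H *ᵥ b) = star (star b ⬝ᵥ (H *ᵥ a)) := by
    simp only [dotProduct, Matrix.mulVec, Pi.star_apply, Complex.star_def, map_sum, map_mul, Finset.mul_sum,
      Complex.conj_conj]
    rw [Finset.sum_comm]
    refine Finset.sum_congr rfl fun e _ => Finset.sum_congr rfl fun e' _ => ?_
    have hc : (starRingEnd ℂ) (H e e') = H e' e := by simpa [Complex.star_def] using hH.apply e' e
    rw [hc]; ring
  rw [h, Complex.star_def, Complex.conj_re]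

/-- **THE COERCIVITY CONSTANT FROM POSITIVITY AND A BOUND ON THE INVERSE** (planner g1-plan-1 GEN 17, lens note L-19a: [B9] Thm 3.11
is QUALITATIVE positivity; the NUMBER `γ` comes from the k-uniform bound of the inverse, a (3.42)-type letter): a Hermitian `H` with
`Re z^*Hz ≥ 0`, invertible, whose inverse has absolute row AND column sums `≤ S` (e.g. from a kernel bound `|H⁻¹(x,y)| ≤ Ce^{−δd}`
summed) is Re-coercive with `γ = S⁻¹`: `S⁻¹‖x‖² ≤ Re x^*Hx`.  Proof: the quadratic `Re (x − ty)^*H(x − ty) ≥ 0` at `y = H⁻¹x`,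
`t = S⁻¹`, with `x^*Hy = ‖x‖²` and `Re y^*Hy = Re x^*H⁻¹x ≤ S‖x‖²` (36's Schur test at rate `0`).
[cite: Balaban1985BackgroundPropagators, Thm 3.11 p.416, Thm 3.1 (3.42) p.397] -/
theorem reCoercive_of_inv_schur [DecidableEq ι] (H : Matrix ι ι ℂ) (hH : H.IsHermitian) (hunit : IsUnit H.det)
    (hpsd : ∀ z : ι → ℂ, 0 ≤ (star z ⬝ᵥ (H *ᵥ z)).re) {S : ℝ} (hS : 0 < S)
    (hrow : ∀ e, ∑ e', ‖H⁻¹ e e'‖ ≤ S) (hcol : ∀ e', ∑ e, ‖H⁻¹ e e'‖ ≤ S) :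
    ∀ x : ι → ℂ, S⁻¹ * nsq x ≤ (star x ⬝ᵥ (H *ᵥ x)).re := by
  intro x
  set y := H⁻¹ *ᵥ x with hy
  have hHy : H *ᵥ y = x := by rw [hy, Matrix.mulVec_mulVec, Matrix.mul_nonsing_inv _ hunit, Matrix.one_mulVec]
  -- `x^*Hy = ‖x‖²`, and `y^*Hx` has the same real part
  have hb1 : (star x ⬝ᵥ (H *ᵥ y)).re = nsq x := by rw [hHy, star_dotProduct_self]; simp
  have hb2 : (star y ⬝ᵥ (H *ᵥ x)).re = nsq x := by rw [← re_star_dotProduct_mulVec_comm H hH x y, hb1]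
  -- `Re y^*Hy = Re x^*H⁻¹x ≤ S‖x‖²` (Schur test at rate 0)
  have hc : (star y ⬝ᵥ (H *ᵥ y)).re ≤ S * nsq x := by
    rw [hHy]
    have e1 : (star y ⬝ᵥ x).re = (star x ⬝ᵥ (H⁻¹ *ᵥ x)).re := by
      have := re_star_dotProduct_mulVec_comm (1 : Matrix ι ι ℂ) Matrix.isHermitian_one y x
      simpa [Matrix.one_mulVec, hy] using this
    rw [e1, ← conjForm_zero_rate (H⁻¹) (fun _ => (0 : ℝ)) x]
    have hsch := norm_conjForm_le_schur (H⁻¹) 0 (fun _ => (0 : ℝ)) (Sr := S) (Sc := S)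
      (fun e => by simpa [cRow] using hrow e) (fun e' => by simpa [cCol] using hcol e') x
    have h3 := (abs_le.1 ((Complex.abs_re_le_norm (conjForm H⁻¹ 0 (fun _ => (0 : ℝ)) x)).trans hsch)).2
    linarith
  -- the quadratic at `t = S⁻¹`
  have hq := hpsd (x - ((S⁻¹ : ℝ) : ℂ) • y)
  have hexp : (star (x - ((S⁻¹ : ℝ) : ℂ) • y) ⬝ᵥ (H *ᵥ (x - ((S⁻¹ : ℝ) : ℂ) • y))).re =
      (star x ⬝ᵥ (H *ᵥ x)).re - S⁻¹ * (star x ⬝ᵥ (H *ᵥ y)).re - S⁻¹ * (star y ⬝ᵥ (H *ᵥ x)).re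
        + S⁻¹ * S⁻¹ * (star y ⬝ᵥ (H *ᵥ y)).re := by
    simp only [Matrix.mulVec_sub, Matrix.mulVec_smul, star_sub, star_smul, sub_dotProduct, dotProduct_sub,
      smul_dotProduct, dotProduct_smul, smul_eq_mul, Complex.sub_re, Complex.mul_re, Complex.ofReal_re,
      Complex.ofReal_im, Complex.star_def, Complex.conj_ofReal, zero_mul, sub_zero]
    ring
  rw [hexp, hb1, hb2] at hq
  have hSi : 0 < S⁻¹ := inv_pos.2 hS
  have h4 : S⁻¹ * S⁻¹ * (star y ⬝ᵥ (H *ᵥ y)).re ≤ S⁻¹ * S⁻¹ * (S * nsq x) := mul_le_mul_of_nonneg_left hc (by positivity)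
  have h5 : S⁻¹ * S⁻¹ * (S * nsq x) = S⁻¹ * nsq x := by field_simp
  nlinarith [nsq_nonneg x]

end Gamma

/-! ## §5. The COSH (second-order) packaging — η-uniform for Laplacian-shape kernels (planner g1-plan-1 GEN 17, skeleton #20, credited) -/

section Cosh

variable (ds : ι → ι → ℝ)

omit [Fintype ι] in
/-- `cosh(κ(ρ_e − ρ_{e′})) − 1 ≤ cosh(κr) − 1` when `|ρ_e − ρ_{e′}| ≤ r`, `κ ≥ 0`. (Skeleton #20 §1, credited.) [folklore] -/
theorem ctWeight_le_cosh_of_abs_sub_le {κ r : ℝ} (hκ : 0 ≤ κ) {ρ : ι → ℝ} {e e' : ι} (h : |ρ e - ρ e'| ≤ r) :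
    Beta.DeltaACombesThomas.ctWeight κ ρ e e' ≤ Real.cosh (κ * r) - 1 := by
  have ht : |κ * (ρ e - ρ e')| ≤ |κ * r| := by
    rw [abs_mul, abs_of_nonneg hκ, abs_mul, abs_of_nonneg hκ]
    exact mul_le_mul_of_nonneg_left (h.trans (le_abs_self r)) hκ
  have hc := Real.cosh_le_cosh.2 ht
  unfold Beta.DeltaACombesThomas.ctWeight
  linarith

/-- **Cosh row defect from RANGE with the OFF-DIAGONAL row mass** `Σ_{e′ ≠ e}‖H(e,e′)‖ ≤ M_off`: `ctRowDefect ≤ M_off(cosh(κr) − 1)`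
(the diagonal carries weight `cosh 0 − 1 = 0`; SECOND order in `κr`). (Skeleton #20 §1, credited.) [folklore] -/
theorem ctRowDefect_le_of_range_cosh [DecidableEq ι] (H : Matrix ι ι ℂ) {κ r Moff : ℝ} (hκ : 0 ≤ κ) (ρ : ι → ℝ)
    (hH : ∀ e e', H e e' ≠ 0 → |ρ e - ρ e'| ≤ r) (hM : ∀ e, ∑ e', (if e' = e then (0 : ℝ) else ‖H e e'‖) ≤ Moff) (e : ι) :
    ctRowDefect H κ ρ e ≤ Moff * (Real.cosh (κ * r) - 1) := by
  have hc1 : 0 ≤ Real.cosh (κ * r) - 1 := by linarith [Real.one_le_cosh (κ * r)]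
  calc ctRowDefect H κ ρ e = ∑ e', ‖H e e'‖ * Beta.DeltaACombesThomas.ctWeight κ ρ e e' := rfl
    _ ≤ ∑ e', (if e' = e then (0 : ℝ) else ‖H e e'‖) * (Real.cosh (κ * r) - 1) := by
        refine Finset.sum_le_sum fun e' _ => ?_
        by_cases hee : e' = e
        · subst hee
          simp [Beta.DeltaACombesThomas.ctWeight]
        · rw [if_neg hee]
          by_cases h0 : H e e' = 0
          · simp [h0]
          · exact mul_le_mul_of_nonneg_left (ctWeight_le_cosh_of_abs_sub_le hκ (hH e e' h0)) (norm_nonneg _)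
    _ = (∑ e', (if e' = e then (0 : ℝ) else ‖H e e'‖)) * (Real.cosh (κ * r) - 1) := by rw [Finset.sum_mul]
    _ ≤ Moff * (Real.cosh (κ * r) - 1) := mul_le_mul_of_nonneg_right (hM e) hc1

/-- **CONJUGATED COERCIVITY, COSH MARGIN** (§2 sharpened): Hermitian `H` Re-coercive `γ`, `ds`-range `r₁`, OFF-DIAGONAL row sums
`≤ M_off` ⟹ `(γ − M_off(cosh(κr₁) − 1))‖z‖² ≤ Re conjForm H κ (ds(·,j)) z` for every `κ ≥ 0` and column `j` — second order in `κr₁`,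
hence η-UNIFORM for nearest-neighbour fine-lattice Laplacian shapes (`lapShape_cosh_budget_le`), where §2's first-order packaging
with the full row mass is not. (Skeleton #20 §2, credited.) [cite: Balaban1985BackgroundPropagators, Thm 3.11 p.416, (3.24) p.394] -/
theorem conjCoercive_of_hermitian_range_cosh [DecidableEq ι] (hsymm : ∀ i j, ds i j = ds j i)
    (htri : ∀ i j k, ds i k ≤ ds i j + ds j k) (H : Matrix ι ι ℂ) (hH : H.IsHermitian) {γ κ r₁ Moff : ℝ} (hκ : 0 ≤ κ)
    (hγ : ∀ z : ι → ℂ, γ * nsq z ≤ (star z ⬝ᵥ (H *ᵥ z)).re)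
    (hrange : ∀ e e', H e e' ≠ 0 → ds e e' ≤ r₁) (hrow : ∀ e, ∑ e', (if e' = e then (0 : ℝ) else ‖H e e'‖) ≤ Moff) (j : ι) :
    ∀ z : ι → ℂ, (γ - Moff * (Real.cosh (κ * r₁) - 1)) * nsq z ≤ (conjForm H κ (fun e => ds e j) z).re := by
  have hJ : ∀ e, ctRowDefect H κ (fun e => ds e j) e ≤ Moff * (Real.cosh (κ * r₁) - 1) :=
    ctRowDefect_le_of_range_cosh H hκ (fun e => ds e j)
      (fun e e' hne => (abs_weight_sub_le ds hsymm htri j e e').trans (hrange e e' hne)) hrow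
  exact conjCoercive_of_conjLower hγ (conjLower_of_isHermitian H hH κ (fun e => ds e j) hJ)

variable {E : Type*} [NormedAddCommGroup E]

/-- **`hcoer` WITH THE COSH MARGIN**: §3's letter with §5's base coercivity — `A(u) = H + R(u)`, conjugated Schur sums `(c_r, c_c)`
of the complex remainder ⟹ margin `γ − M_off(cosh(κr₁) − 1) − ½(c_r + c_c)` uniformly on the ball.
[cite: Balaban1985BackgroundPropagators, Thm 3.11 p.416, (3.37) p.396, (3.63)–(3.64) p.402] -/
theorem hcoer_of_hermitian_range_schur_cosh [DecidableEq ι] (hsymm : ∀ i j, ds i j = ds j i)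
    (htri : ∀ i j k, ds i k ≤ ds i j + ds j k) {A : E → Matrix ι ι ℂ} (H : Matrix ι ι ℂ) (hH : H.IsHermitian)
    {R γ κ r₁ Moff cr cc : ℝ} (hκ : 0 ≤ κ)
    (hγ : ∀ z : ι → ℂ, γ * nsq z ≤ (star z ⬝ᵥ (H *ᵥ z)).re)
    (hrange : ∀ e e', H e e' ≠ 0 → ds e e' ≤ r₁) (hrow : ∀ e, ∑ e', (if e' = e then (0 : ℝ) else ‖H e e'‖) ≤ Moff)
    (hr : ∀ u ∈ ball (0 : E) R, ∀ j e, cRow (A u - H) κ (fun e => ds e j) e ≤ cr)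
    (hc : ∀ u ∈ ball (0 : E) R, ∀ j e', cCol (A u - H) κ (fun e => ds e j) e' ≤ cc) :
    ∀ u ∈ ball (0 : E) R, ∀ j, ∀ z : ι → ℂ,
      (γ - Moff * (Real.cosh (κ * r₁) - 1) - (cr + cc) / 2) * nsq z ≤ (conjForm (A u) κ (fun e => ds e j) z).re :=
  conjCoercive_uniform_of_schur H ds (conjCoercive_of_hermitian_range_cosh ds hsymm htri H hH hκ hγ hrange hrow) hr hc

/-- `cosh t − 1 ≤ (t²∕2)e^{t²∕2}`. (Skeleton #20 §3, credited.) [folklore] -/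
theorem cosh_sub_one_le (t : ℝ) : Real.cosh t - 1 ≤ t ^ 2 / 2 * Real.exp (t ^ 2 / 2) := by
  have h1 : Real.cosh t ≤ Real.exp (t ^ 2 / 2) := Real.cosh_le_exp_half_sq t
  have h2 : 1 - t ^ 2 / 2 ≤ Real.exp (-(t ^ 2 / 2)) := Real.one_sub_le_exp_neg _
  have h3 : Real.exp (-(t ^ 2 / 2)) * Real.exp (t ^ 2 / 2) = 1 := by
    rw [← Real.exp_add]; simp
  have hpos : 0 < Real.exp (t ^ 2 / 2) := Real.exp_pos _
  have h4 : (1 - t ^ 2 / 2) * Real.exp (t ^ 2 / 2) ≤ 1 := by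
    calc (1 - t ^ 2 / 2) * Real.exp (t ^ 2 / 2) ≤ Real.exp (-(t ^ 2 / 2)) * Real.exp (t ^ 2 / 2) :=
          mul_le_mul_of_nonneg_right h2 hpos.le
      _ = 1 := h3
  nlinarith [h1, h4, hpos]

/-- **η-UNIFORMITY OF THE COSH BUDGET FOR LAPLACIAN SHAPES**: off-diagonal row mass `2d∕η²`, range `η` ⟹
`(2d∕η²)(cosh(κη) − 1) ≤ dκ²e^{(κη)²∕2}` — bounded as `η → 0` (the first-order packaging of §2 with the full row mass `4d∕η²` gives
`≥ 4dκ∕η`, not η-uniform). (Skeleton #20 §3, credited.) [folklore] -/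
theorem lapShape_cosh_budget_le {d η κ : ℝ} (hd : 0 ≤ d) (hη : 0 < η) :
    2 * d / η ^ 2 * (Real.cosh (κ * η) - 1) ≤ d * κ ^ 2 * Real.exp ((κ * η) ^ 2 / 2) := by
  have h := cosh_sub_one_le (κ * η)
  have hη2 : 0 < η ^ 2 := by positivity
  calc 2 * d / η ^ 2 * (Real.cosh (κ * η) - 1) ≤ 2 * d / η ^ 2 * ((κ * η) ^ 2 / 2 * Real.exp ((κ * η) ^ 2 / 2)) :=
        mul_le_mul_of_nonneg_left h (by positivity)
    _ = d * κ ^ 2 * Real.exp ((κ * η) ^ 2 / 2) := by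
        field_simp

end Cosh

end Summit.QuantumFields.BalabanUV.Gaps.D4WalkBlockCoerciveLetter

end
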